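import Summits.NavierStokesRegularity.NavierStokesRegularity.Theorems.TypeICertificateLadderTargetLambEnergySlack
import Summits.NavierStokesRegularity.NavierStokesRegularity.Theorems.TypeICertificateLadderTargetLogisticBarrier
import Summits.NavierStokesRegularity.NavierStokesRegularity.Theorems.DssFarFieldSlavingBlowupTypeIDssProfileSimilarityEnstrophyLambCore
import HarnessLib

/-!
# Crux `Target` = `TypeICertificateLadder.NoTypeIBlowup` (stmt-NavierStokesRegularity-1217), line
# `depletion-ladder`: the LOGISTIC enstrophy bound on a slab

`--supports stmt-NavierStokesRegularity-1217` (line `depletion-ladder`; slab form of the Lamb–energy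
slack `DepletionLadder.integral_sum_inner_fderiv_le_lamb_energy`, p482516).

On a Tao-class slab `[0, T] × ℝ³` (classical solution of the unforced system, all `L²` Sobolev norms
of `u`, `∂ₜu`, `p` bounded) with `|u| ≤ M` and `‖u(t)‖₂² ≤ E₀` on the slab, the enstrophy
`G(t) = ∫ |∇u(t)|²_F` satisfies the integral form of the LOGISTIC inequality

  `dG/dt ≤ (M²/(2ν)) G − (2ν/E₀) G²`

(enstrophy balance `IsSmoothSpaceTimeOn.enstrophy_balance`, the slice bound with the Lamb–energy slack
at interior times, `∫|u|²|curl u|² ≤ M² ∫|curl u|² = M² G` by the whole-space `div`–`curl` identity),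
hence, by the barrier lemma `le_max_of_logistic_integral_ineq`, the UNIFORM bound
(`frobeniusNormSq_fderiv_le_max_logistic`)

  `∫ |∇u(t)|²_F ≤ max ( ∫ |∇u(0)|²_F , M² E₀ / (4ν²) )`   for all `t ∈ [0, T]`,

in place of the exponential `exp(M² t/(2ν)) ∫|∇u(0)|²_F` of the classical slab estimate
(`lintegral_frobeniusNormSq_fderiv_le_mul_exp`, Lemarié-Rieusset 2016 Thm. 11.2): with bounded speed
the enstrophy can never exceed the carrying capacity `‖u‖²_∞ ‖u‖₂²/(4ν²)` unless it started above it.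

WHAT THIS IS NOT: not a regularity statement (the sup norm is assumed); under a Type-I rate
`M² ~ C²ν/(T−t)` the capacity grows like `(T−t)⁻¹`, above the `H¹` blow-up exponent `1/2`, so no rung
follows (companion a-priori file). Elementary. [folklore]

References: Lemarié-Rieusset 2016, Thm. 11.2; Doering–Gibbon 1995, ch. 5–6; T. Tao, Anal. PDE 6
(2013), Thm. 5.4 (the class).
-/

noncomputable section

open Set Filter Topology MeasureTheory
open scoped RealInnerProductSpace ENNReal NNReal Laplacian ContDiff
open Literature.Analysis.FluidPDE

namespace Summit.NavierStokesRegularity.NavierStokesRegularity.Theorems.DepletionLadder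

-- the problem directory repeats the summit name (`NavierStokesRegularity/NavierStokesRegularity`)
set_option linter.dupNamespace false

open Summit.NavierStokesRegularity.NavierStokesRegularity.Theorems.RungReynoldsOne
open Summit.NavierStokesRegularity.NavierStokesRegularity.Theorems.SimilarityEnstrophy

/-- A continuous square-integrable field with `∫ ‖v‖² = 0` vanishes identically, hence so does
`∫ |∇v|²_F`. [folklore] -/
theorem integral_frobeniusNormSq_fderiv_eq_zero_of_integral_sq_eq_zero
    {v : EuclideanSpace ℝ (Fin 3) → EuclideanSpace ℝ (Fin 3)} (hv : Continuous v)
    (hi : Integrable (fun x => ‖v x‖ ^ 2) volume) (h0 : ∫ x, ‖v x‖ ^ 2 = 0) :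
    ∫ x, frobeniusNormSq (fderiv ℝ v x) = 0 := by
  have hae : (fun x => ‖v x‖ ^ 2) =ᵐ[volume] 0 :=
    (integral_eq_zero_iff_of_nonneg (fun x => sq_nonneg _) hi).1 h0
  have hzero : (fun x => ‖v x‖ ^ 2) = 0 :=
    (hv.norm.pow 2).ae_eq_iff_eq volume continuous_const |>.1 hae
  have hv0 : v = fun _ => 0 := by
    funext x
    have := congrFun hzero x
    simpa using this
  have hD : ∀ x, fderiv ℝ v x = 0 := fun x => by rw [hv0]; simp
  simp [hD, frobeniusNormSq]

/-- **The logistic enstrophy bound on a slab.** For a classical solution of the unforced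
Navier–Stokes system with viscosity `ν > 0` on `[0, T] × ℝ³` in Tao's class (`u`, `∂ₜu`, `p` with all
`L²` Sobolev norms bounded on the slab), with `|u| ≤ M` and `∫‖u(t)‖² ≤ E₀` (`E₀ > 0`) on the slab:
`∫ |∇u(t)|²_F ≤ max (∫ |∇u(0)|²_F) (M² E₀/(4ν²))` for every `t ∈ [0, T]`. Proof: enstrophy balance
(`IsSmoothSpaceTimeOn.enstrophy_balance`), at interior times the Lamb–energy slice bound
`integral_sum_inner_fderiv_le_lamb_energy` with `∫|u|²|curl u|² ≤ M² ∫|∇u|²_F`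
(`integral_norm_curl_sq_eq_integral_frobeniusNormSq`) and `∫‖u‖² ≤ E₀`, i.e.
`dG/dt ≤ (M²/(2ν))G − (2ν/E₀)G²`, then the barrier `le_max_of_logistic_integral_ineq`. [folklore] -/
theorem frobeniusNormSq_fderiv_le_max_logistic {ν T : ℝ} (hν : 0 < ν) (hT : 0 < T)
    {u : ℝ → EuclideanSpace ℝ (Fin 3) → EuclideanSpace ℝ (Fin 3)}
    {p : ℝ → EuclideanSpace ℝ (Fin 3) → ℝ} (hsol : IsClassicalNSSolutionOn (Icc 0 T) ν 0 u p)
    (hu : HasBoundedSobolevNormsOn (Icc 0 T) u)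
    (hut : HasBoundedSobolevNormsOn (Icc 0 T) (timeDerivWithin (Icc 0 T) u))
    (hp : ∀ n : ℕ, ∃ C : ℝ≥0, ∀ t ∈ Icc 0 T, ∫⁻ x, ‖iteratedFDeriv ℝ n (p t) x‖ₑ ^ 2 ≤ C)
    {M E₀ : ℝ} (hE₀ : 0 < E₀) (hM : ∀ t ∈ Icc 0 T, ∀ x, ‖u t x‖ ≤ M)
    (hE : ∀ t ∈ Icc 0 T, ∫ x, ‖u t x‖ ^ 2 ≤ E₀) :
    ∀ t ∈ Icc 0 T, ∫ x, frobeniusNormSq (fderiv ℝ (u t) x) ≤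
      max (∫ x, frobeniusNormSq (fderiv ℝ (u 0) x)) (M ^ 2 * E₀ / (4 * ν ^ 2)) := by
  set e := EuclideanSpace.basisFun (Fin 3) ℝ with he
  have hU : UniqueDiffOn ℝ (Icc 0 T) := uniqueDiffOn_Icc hT
  set W : ℝ → EuclideanSpace ℝ (Fin 3) → EuclideanSpace ℝ (Fin 3) :=
    timeDerivWithin (Icc 0 T) u with hW
  have hWsm : IsSmoothSpaceTimeOn (Icc 0 T) W := hsol.smooth_velocity.timeDerivWithin hU
  have hM0 : 0 ≤ M := (norm_nonneg _).trans (hM 0 ⟨le_rfl, hT.le⟩ 0)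
  obtain ⟨C₀, hC₀⟩ := hu 0
  obtain ⟨C₁, hC₁⟩ := hu 1
  obtain ⟨D₂, hD₂⟩ := hu 2
  obtain ⟨E₀', hE₀'⟩ := hut 0
  obtain ⟨E₁, hE₁⟩ := hut 1
  obtain ⟨P₀, hP₀⟩ := hp 0
  obtain ⟨P₁, hP₁⟩ := hp 1
  have hzero : ∀ {F : Type} [NormedAddCommGroup F] [NormedSpace ℝ F]
      {f : EuclideanSpace ℝ (Fin 3) → F} {C' : ℝ≥0},
      (∫⁻ x, ‖iteratedFDeriv ℝ 0 f x‖ₑ ^ 2 ≤ C') → ∫⁻ x, ‖f x‖ₑ ^ 2 < ⊤ := by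
    intro F _ _ f C' h
    refine lt_of_le_of_lt ((le_of_eq (lintegral_congr fun x => ?_)).trans h) ENNReal.coe_lt_top
    rw [← ofReal_norm, ← ofReal_norm, norm_iteratedFDeriv_zero]
  -- the enstrophy balance
  obtain ⟨hΦint, -, hGb⟩ := hsol.smooth_velocity.enstrophy_balance hT hC₁ hE₁
  set Φ : ℝ → ℝ := fun t => ∫ x, 2 * ∑ i, ⟪fderiv ℝ (u t) x (e i), fderiv ℝ (W t) x (e i)⟫ with hΦ
  set G : ℝ → ℝ := fun t => ∫ x, frobeniusNormSq (fderiv ℝ (u t) x) with hG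
  have hfrob_lt : ∀ t ∈ Icc 0 T,
      ∫⁻ x, ENNReal.ofReal (frobeniusNormSq (fderiv ℝ (u t) x)) < ⊤ := by
    intro t ht
    calc ∫⁻ x, ENNReal.ofReal (frobeniusNormSq (fderiv ℝ (u t) x))
        ≤ ∫⁻ x, 3 * ‖iteratedFDeriv ℝ 1 (u t) x‖ₑ ^ 2 := lintegral_mono fun x => by
          rw [← ofReal_norm, norm_iteratedFDeriv_one, ofReal_norm]
          exact ofReal_frobeniusNormSq_le_three_mul_enorm_sq _
      _ = 3 * ∫⁻ x, ‖iteratedFDeriv ℝ 1 (u t) x‖ₑ ^ 2 := lintegral_const_mul' _ _ (by norm_num)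
      _ ≤ 3 * C₁ := by gcongr; exact hC₁ t ht
      _ < ⊤ := ENNReal.mul_lt_top (by norm_num) ENNReal.coe_lt_top
  -- THE SLICE BOUND at interior times: `Φ t ≤ (M²/(2ν)) G t − (2ν/E₀) (G t)²`
  have hslice : ∀ t ∈ Ioo 0 T, Φ t ≤ M ^ 2 / (2 * ν) * G t - 2 * ν / E₀ * G t ^ 2 := by
    intro t ht
    have htI : t ∈ Icc 0 T := Ioo_subset_Icc_self ht
    have hu2 : ContDiff ℝ 2 (u t) := (hsol.contDiff_velocity htI).of_le (by norm_cast)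
    have hu1 : ContDiff ℝ 1 (u t) := hu2.of_le (by norm_num)
    have cu : Continuous (u t) := hu2.continuous
    have cDu : Continuous (fderiv ℝ (u t)) := hu2.continuous_fderiv (by norm_num)
    have ccurl : Continuous (curl (u t)) := continuous_curl hu1
    have hmom : ∀ x, W t x + convect (u t) (u t) x = ν • (Δ (u t)) x - gradient (p t) x := by
      intro x
      have h := hsol.momentum t htI x
      simpa [hW] using h
    have hv0 : ∫⁻ x, ‖u t x‖ₑ ^ 2 < ⊤ := hzero (hC₀ t htI)
    have hsl := integral_sum_inner_fderiv_le_lamb_energy hν hu2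
      ((hWsm.contDiff_slice htI).of_le (by norm_cast))
      ((hsol.contDiff_pressure htI).of_le (by norm_cast)) hmom (hsol.divFree t htI)
      (isDivFree_timeDerivWithin hsol.smooth_velocity hsol.divFree ht) (hM t htI)
      hv0 (hfrob_lt t htI) ((hD₂ t htI).trans_lt ENNReal.coe_lt_top)
      (hzero (hE₀' t htI)) ((hE₁ t htI).trans_lt ENNReal.coe_lt_top)
      (hzero (hP₀ t htI)) ((hP₁ t htI).trans_lt ENNReal.coe_lt_top)
    -- `∫|u|²|curl u|² ≤ M² G t`
    have l2Du : ∫⁻ x, ‖fderiv ℝ (u t) x‖ₑ ^ 2 < ⊤ := lintegral_enorm_sq_fderiv_lt_top (hfrob_lt t htI)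
    have l2ω : ∫⁻ x, ‖curl (u t) x‖ₑ ^ 2 < ⊤ :=
      lintegral_enorm_sq_lt_top_of_norm_le (b := fun x => ‖curlCLM‖ * ‖fderiv ℝ (u t) x‖)
        (fun x => (norm_curl_le (u t) x).trans (Real.le_norm_self _))
        (lintegral_enorm_sq_const_mul_norm_lt_top _ l2Du)
    have iF : Integrable (fun x => frobeniusNormSq (fderiv ℝ (u t) x)) volume :=
      integrable_of_continuous_of_nonneg (continuous_frobeniusNormSq_fderiv hu2 (by simp))
        (fun x => frobeniusNormSq_nonneg _) (hfrob_lt t htI)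
    have iC : Integrable (fun x => ‖curl (u t) x‖ ^ 2) volume :=
      integrable_sq_norm_of_lintegral_lt_top ccurl l2ω
    have iT : Integrable (convect (u t) (u t)) volume :=
      integrable_of_norm_le_mul_of_lintegral_sq (cDu.clm_apply cu).aestronglyMeasurable cDu cu l2Du hv0
        fun x => (fderiv ℝ (u t) x).le_opNorm (u t x)
    have hZ : ∫ x, ‖curl (u t) x‖ ^ 2 = G t :=
      integral_norm_curl_sq_eq_integral_frobeniusNormSq hu2 (hsol.divFree t htI) iF iC iT
    have iMC : Integrable (fun x => M ^ 2 * ‖curl (u t) x‖ ^ 2) volume := iC.const_mul _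
    have isqc : Integrable (fun x => ‖u t x‖ ^ 2 * ‖curl (u t) x‖ ^ 2) volume := by
      refine iMC.mono' ((cu.norm.pow 2).mul (ccurl.norm.pow 2)).aestronglyMeasurable
        (Eventually.of_forall fun x => ?_)
      rw [Real.norm_of_nonneg (by positivity)]
      exact mul_le_mul_of_nonneg_right (pow_le_pow_left₀ (norm_nonneg _) (hM t htI x) 2) (sq_nonneg _)
    have hP2 : ∫ x, ‖u t x‖ ^ 2 * ‖curl (u t) x‖ ^ 2 ≤ M ^ 2 * G t := by
      rw [← hZ, ← integral_const_mul]
      exact integral_mono isqc iMC fun x =>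
        mul_le_mul_of_nonneg_right (pow_le_pow_left₀ (norm_nonneg _) (hM t htI x) 2) (sq_nonneg _)
    -- the energy term: `G²/E₀ ≤ G²/E(t)` (or `G = 0`)
    have isq : Integrable (fun x => ‖u t x‖ ^ 2) volume := integrable_sq_norm_of_lintegral_lt_top cu hv0
    have hEt0 : 0 ≤ ∫ x, ‖u t x‖ ^ 2 := integral_nonneg fun x => sq_nonneg _
    have hlog : -(ν * G t ^ 2 / ∫ x, ‖u t x‖ ^ 2) ≤ -(ν * G t ^ 2 / E₀) := by
      rcases eq_or_lt_of_le hEt0 with hE00 | hEpos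
      · have hG0 : G t = 0 := integral_frobeniusNormSq_fderiv_eq_zero_of_integral_sq_eq_zero cu isq hE00.symm
        rw [hG0]; simp
      · have h1 : ν * G t ^ 2 / E₀ ≤ ν * G t ^ 2 / ∫ x, ‖u t x‖ ^ 2 :=
          div_le_div_of_nonneg_left (by positivity) hEpos (hE t htI)
        linarith
    -- assemble
    have hGt : ∫ x, frobeniusNormSq (fderiv ℝ (u t) x) = G t := rfl
    rw [hGt] at hsl
    have hΦt : Φ t = 2 * ∫ x, ∑ i, ⟪fderiv ℝ (u t) x (e i), fderiv ℝ (W t) x (e i)⟫ :=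
      integral_const_mul _ _
    rw [hΦt]
    have h2 := mul_le_mul_of_nonneg_left hsl zero_le_two
    have h3 : (4 * ν)⁻¹ * (∫ x, ‖u t x‖ ^ 2 * ‖curl (u t) x‖ ^ 2) ≤ (4 * ν)⁻¹ * (M ^ 2 * G t) :=
      mul_le_mul_of_nonneg_left hP2 (by positivity)
    calc 2 * ∫ x, ∑ i, ⟪fderiv ℝ (u t) x (e i), fderiv ℝ (W t) x (e i)⟫
        ≤ 2 * ((4 * ν)⁻¹ * (∫ x, ‖u t x‖ ^ 2 * ‖curl (u t) x‖ ^ 2) -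
            ν * G t ^ 2 / ∫ x, ‖u t x‖ ^ 2) := h2
      _ ≤ 2 * ((4 * ν)⁻¹ * (M ^ 2 * G t)) - 2 * (ν * G t ^ 2 / E₀) := by linarith [h3, hlog]
      _ = M ^ 2 / (2 * ν) * G t - 2 * ν / E₀ * G t ^ 2 := by
          field_simp
          ring
  -- the barrier
  have hGb' : ∀ t ∈ Icc 0 T, G t = G 0 + ∫ τ in (0 : ℝ)..t, Φ τ := by
    intro t ht
    rcases eq_or_lt_of_le ht.1 with h0 | ht0
    · rw [← h0]; simp
    · exact hGb t ⟨ht0, ht.2⟩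
  have hb : 0 < 2 * ν / E₀ := by positivity
  have hbar := le_max_of_logistic_integral_ineq (z := G) (φ := Φ) hT (by positivity) hb hΦint hGb'
    hslice
  intro t ht
  have h := hbar t ht
  have hab : M ^ 2 / (2 * ν) / (2 * ν / E₀) = M ^ 2 * E₀ / (4 * ν ^ 2) := by
    field_simp
    ring
  rw [hab] at h
  exact h

end Summit.NavierStokesRegularity.NavierStokesRegularity.Theorems.DepletionLadder

end
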